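import Summits.AnomalousDissipation.AnomalousDissipation.Theses.FrustratedForces
import Summits.AnomalousDissipation.AnomalousDissipation.Theorems.MirrorVarietySteadyWeakIsGlobalLerayHopf
import Summits.AnomalousDissipation.AnomalousDissipation.Theorems.TaylorCertificatesSteadyStatesLoudBoundedStubGpAdmissible
import Literature.Analysis.FluidPDE.SteadyNavierStokesEnergy
import Literature.Analysis.FluidPDE.StatisticalSolutionEnergyEq

/-!
# Crux `GPLoudFamilyZ` (stmt-AnomalousDissipation-10436, route FrustratedForces, rank 4) — birth skeleton

`Lines/birth.lean`: the BOUNDED-STEADY-STATES-ARE-LOUD skeleton of the crux (the steady shadow of the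
route's own ENERGY / LOUDNESS split, cut exactly where a constructive proof through invariant states must
deliver). Two named stubs and the kernel-checked composition
`GPLoudFamilyZ_of : stub₁ → stub₂ → GPLoudFamilyZ` (hypotheses = the name-keyed aliases
`__Registered.stub_*` of the two stub signatures, see § aliases; wiring `example` at the end), concluding
the route decl `Summit.AnomalousDissipation.AnomalousDissipation.Theses.FrustratedForces.GPLoudFamilyZ`
BY NAME; sorries only inside the two `stub_*`.

The crux asks, for the pinned Galloway–Proctor/Archontis force
`f_GP(x) = sin(2πx₂)e₀ + sin(2πx₀)e₁ + sin(2πx₁)e₂` (inline sum of three Stokes modes, as in the route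
file), for `ε > 0`, viscosities `ν_j → 0` in `(0,1]`, ZERO-MEAN data and global Leray–Hopf solutions
`u_j` of `NS_{ν_j}(f_GP)` with `meanDissipation (ν_j) (u_j) ≥ ε`.  Leray–Hopf solutions only obey
`meanDissipation ≤ ⟨(f,u)⟩`, so a dissipation FLOOR needs witnesses with the energy EQUALITY; the
cheapest such class that is unconditionally realisable as Leray–Hopf is the class of STEADY weak
solutions `u ∈ V` (Temam: in `d ≤ 4` every steady weak solution satisfies `ν‖∇u‖² = (u,f)`; tree
theorem `Torus.IsSteadyWeakSolution.energy_eq'`), viewed as constant paths (tree theorem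
`Theorems.steadyWeakIsGlobalLerayHopf_proof`, MirrorVariety stmt-2992: global Leray–Hopf with
`meanDissipation = ν‖∇u‖²`; data in `H`, hence mean zero, `Torus.integral_eq_zero_of_mem_energySpace`).
For a steady state LOUDNESS IS POWER: `meanDissipation = ν‖∇u‖² = (u, f_GP)`.  The line cuts the
existence of loud steady GP states at arbitrarily small viscosity along the two things such a proof
must deliver — an ENERGY statement and a LOUDNESS statement, glued at a common energy level `E`:

* `stub_boundedSteadyGPStates` (ENERGY / EXISTENCE bet, size L–XL): there is an energy level `E` such
  that at arbitrarily small viscosity `NS_ν(f_GP)` has a steady weak solution `u ∈ V` with `‖u‖² ≤ E`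
  (`liminf` form: `∀ ν₀ > 0 ∃ ν ∈ (0, ν₀)`).  Steady states exist at every `ν` (Leray–Schauder /
  Galerkin, `Temam1979_exists_steadyWeakSolution`), a priori only with `‖u‖ ≲ ‖f‖/ν`; for a RESONANT
  force (Kolmogorov, ABC) the laminar branch has `‖u‖ ≍ ν⁻¹` and nothing bounded is known; for the
  FRUSTRATED force `f_GP` (no laminar state: `(f_GP·∇)f_GP` is not a gradient; route crux
  GPSteadySubGrashof: every steady branch is sub-Grashof) the hub's Galerkin census of the GP steady
  variety (kit j001684/j001712/j001732) found BOUNDED ends of the Stokes arc at truncations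
  `K² ∈ {6, 11, 12, 14}` and bounded calm crossings of the wind-line (route WindLine, `⟨|U|²⟩ ≤ 34–60`
  at `K² = 6`).  About ENERGY only.
* `stub_boundedSteadyGPStatesLoud` (LOUDNESS bet = EULER-COERCIVITY OF `f_GP` ON THE STEADY CLASS,
  size XL, the hardest stub): for every energy level `E` there are `ε(E) > 0` and `ν₁(E) > 0` such that
  for `ν < ν₁` EVERY steady weak solution `u ∈ V` of `NS_ν(f_GP)` with `‖u‖² ≤ E` receives power
  `(u, f_GP) ≥ ε`.  Contrapositive: a bounded QUIET steady family `u_ν` (`‖u_ν‖² ≤ E`,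
  `(u_ν, f_GP) → 0` along `ν → 0`) has weak-`L²` limit points `ū` with `(ū, f_GP) = 0` (power is weakly
  continuous — route SteadyWeakLimit, `InjectionWeaklyContinuous`, proved) which are bounded WORK-FREE
  steady Euler–Reynolds states driven by `f_GP` (the force balanced entirely by the Reynolds stress of an
  `O(1)`-energy field with vanishing dissipation); the bet is that the frustrated force admits none
  (card euler-coercive-force specialised to `f_GP`; a priori `(u,f) = ν‖∇u‖² ≥ 16π⁴ν‖u‖²·…` gives only
  a floor of order `ν`).  About LOUDNESS only; universal, so that it GLUES with stub 1 at the level `E`.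

Composition (`GPLoudFamilyZ_of`, no sorry): `E` from stub 1; `ε, ν₁` from stub 2 at `E`; thresholds
`μ/(j+1)`, `μ := min ν₁ 1`; `choose` from stub 1 a viscosity `ν_j ∈ (0, μ/(j+1))` and a bounded steady
state `u_j ∈ V` at each `j` (so `ν_j ≤ 1`, `ν_j < ν₁`, `ν_j → 0` by squeezing); stub 2 makes `u_j` loud,
`ε ≤ (u_j, f_GP)`; Temam's energy identity turns power into `ν_j‖∇u_j‖²`; the realisation theorem makes
the constant path a global Leray–Hopf solution from the datum `u_j ∈ H` (mean zero) with
`meanDissipation (ν_j) = ν_j‖∇u_j‖²`; admissibility of `f_GP` (smooth, mean zero) is the tree theorem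
`Theorems.SteadyStatesLoudBounded.GpAdmissible.stub_gpAdmissible`.

Disproof used: none relevant (no `Disproof.lean` / `Negative/` lemma exists for this crux at registration,
`ledger crux ls stmt-AnomalousDissipation-10436`: no workfiles). Negatives index of the summit: the two
refuted statements of this route (GPEnergyCeiling stmt-2979, EnsembleCeilingBridge stmt-2984) are ANY-MEAN
energy statements killed by Galilean-drift data; both stubs here quantify over steady states in `V ⊆ H`
(mean zero) and claim no energy ceiling.

Hardest stub: `stub_boundedSteadyGPStatesLoud` (its failure mode — a bounded but QUIET steady GP state at
small `ν`, a "dodger": the census reports bounded quiet dodger ENDS of the Stokes arc at four Galerkin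
truncations, continuum fate open — is exactly the crux's recorded why-might-fail restricted to the steady
class). Sources: Temam1979 Ch. II Thm 1.2; FoiasManleyRosaTemam2001 (12.38)–(12.39); HoangJolly2024 =
arXiv:2402.13346 §4; Cheskidov2023 = arXiv:2311.04182 §1.2; AlexakisDoering2006PLA; BorueOrszag1996;
ChildressKerswellGilbert2001.
-/

-- `Summit.<Summit>.<Problem>` is the tree's mandated summit-side namespace (CONVENTIONS §2); for this
-- single-conjunct summit the two coincide, so the duplicate is deliberate.
set_option linter.dupNamespace false

noncomputable section

open Filter Set Topology

namespace Summit.AnomalousDissipation.AnomalousDissipation.Cruxes.GPLoudFamilyZ.Birth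

/-- **stub 1 — bounded steady GP states at arbitrarily small viscosity** (the energy / existence bet;
size L–XL).  There is an energy level `E` such that for every `ν₀ > 0` some viscosity `ν ∈ (0, ν₀)` carries
a steady weak solution `u ∈ V` of `NS_ν(f_GP)` (`Torus.IsSteadyWeakSolution`: `(f,w) + ν(u,Δw) +
∫(u⊗u):∇w = 0` for all smooth divergence-free mean-zero `w`) of energy `‖u‖²_{L²} ≤ E`.  Why plausibly
true: `f_GP` is frustrated (no laminar `ν⁻¹` state; every steady branch sub-Grashof is the route's crux
GPSteadySubGrashof) and the Galerkin census of the GP steady variety finds bounded ends / bounded calm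
wind-line crossings at several truncations; generic finiteness-and-oddness of steady states (Foias–Temam)
forces states off the warm Stokes arc whenever it folds.  Why it might fail: every steady GP state may be
warm, `‖u‖ ≍ ν^{-a}` with `a ∈ (0, 1)` (the census' runaway ends have `a = 1/3`), at ALL small `ν`.
Leans on: `Temam1979_exists_steadyWeakSolution_holds` (existence ∀ν), `LaminarLimitCompactness` /
`GPSteadySubGrashof` (route items), certified continuation (interval Newton in `G = ν⁻²`) for milestones. -/
theorem stub_boundedSteadyGPStates :
    ∃ E : ℝ, ∀ ν₀ : ℝ, 0 < ν₀ → ∃ ν : ℝ, 0 < ν ∧ ν < ν₀ ∧ ∃ u : ↥(Literature.Analysis.FunctionSpaces.Torus.energySpace (Fin 3)), (u : MeasureTheory.Lp (EuclideanSpace ℝ (Fin 3)) 2 (MeasureTheory.volume : MeasureTheory.Measure (UnitAddTorus (Fin 3)))) ∈ Literature.Analysis.FunctionSpaces.Torus.energySpaceV (Fin 3) ∧ Literature.Analysis.FluidPDE.Torus.IsSteadyWeakSolution ν (fun x : UnitAddTorus (Fin 3) => (Literature.Analysis.FluidPDE.Torus.stokesMode (Pi.single (2 : Fin 3) (1 :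 ℤ)) (EuclideanSpace.single (0 : Fin 3) (1 : ℝ)) false x + Literature.Analysis.FluidPDE.Torus.stokesMode (Pi.single (0 : Fin 3) (1 : ℤ)) (EuclideanSpace.single (1 : Fin 3) (1 : ℝ)) false x + Literature.Analysis.FluidPDE.Torus.stokesMode (Pi.single (1 : Fin 3) (1 : ℤ)) (EuclideanSpace.single (2 : Fin 3) (1 : ℝ)) false x : EuclideanSpace ℝ (Fin 3))) u ∧ ‖u‖ ^ 2 ≤ E := by
  sorry

/-- **stub 2 — bounded steady GP states are loud: Euler-coercivity of the frustrated force on the steady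
class** (the loudness bet; size XL, the hardest stub).  For every energy level `E` there are `ε > 0` and
`ν₁ > 0` such that for `0 < ν < ν₁` EVERY steady weak solution `u ∈ V` of `NS_ν(f_GP)` with `‖u‖² ≤ E` has
injected power `(u, f_GP) = ∫⟪u, f_GP⟫ ≥ ε` (equivalently, by Temam's energy identity used only in the
composition, dissipation `ν‖∇u‖² ≥ ε`).  Why plausibly true: a bounded quiet steady family would converge
weakly (power is weakly continuous) to a bounded work-free steady Euler–Reynolds state driven by `f_GP` —
the force absorbed entirely by the Reynolds stress of an `O(1)`-energy field with vanishing dissipation —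
and the frustrated force (`f_GP = ABC⁺/2 + ABC⁻/2`, Beltrami skeletons failing the Newcomb/Livšic test,
shear skeletons failing by lift-up) is the candidate Euler-coercive force of the hub (card
euler-coercive-force).  Why it might fail: bounded QUIET "dodger" steady states at small `ν` — seen as ENDS
of the Stokes arc at Galerkin truncations `K² ∈ {6, 11, 12, 14}` (kit j001684/j001712/j001732; continuum
fate open); in 2-D bounded steady states of single-mode forces laminarise (AlexakisDoering2006: loud ⇒ hot).
Leans on: `InjectionWeaklyContinuous` (SteadyWeakLimit, proved), `LaminarLimitCompactness` (route
support), steady Euler–Reynolds (defect-measure) limits, `Torus.IsSteadyWeakSolution.energy_eq'`. -/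
theorem stub_boundedSteadyGPStatesLoud :
    ∀ E : ℝ, ∃ ε ν₁ : ℝ, 0 < ε ∧ 0 < ν₁ ∧ ∀ ν : ℝ, 0 < ν → ν < ν₁ → ∀ u : ↥(Literature.Analysis.FunctionSpaces.Torus.energySpace (Fin 3)), (u : MeasureTheory.Lp (EuclideanSpace ℝ (Fin 3)) 2 (MeasureTheory.volume : MeasureTheory.Measure (UnitAddTorus (Fin 3)))) ∈ Literature.Analysis.FunctionSpaces.Torus.energySpaceV (Fin 3) → Literature.Analysis.FluidPDE.Torus.IsSteadyWeakSolution ν (fun x : UnitAddTorus (Fin 3) => (Literature.Analysis.FluidPDE.Torus.stokesMode (Pi.single (2 : Fin 3) (1 : ℤ)) (EuclideanSpace.single (0 : Fin 3) (1 : ℝ)) false x + Literature.Analysis.FluidPDE.Torus.stokesMode (Pi.single (0 : Fin 3) (1 : ℤ)) (EuclideanSpace.single (1 : Fin 3) (1 : ℝ)) false x + Literature.Analysis.FluidPDE.Torus.stokesMode (Pi.single (1 : Fin 3) (1 : ℤ)) (EuclideanSpace.single (2 : Fin 3) (1 : ℝ)) false x : EuclideanSpace ℝ (Fin 3))) u →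 ‖u‖ ^ 2 ≤ E → ε ≤ Literature.Analysis.FluidPDE.Torus.pairing (u : MeasureTheory.Lp (EuclideanSpace ℝ (Fin 3)) 2 (MeasureTheory.volume : MeasureTheory.Measure (UnitAddTorus (Fin 3)))) (fun x : UnitAddTorus (Fin 3) => (Literature.Analysis.FluidPDE.Torus.stokesMode (Pi.single (2 : Fin 3) (1 : ℤ)) (EuclideanSpace.single (0 : Fin 3) (1 : ℝ)) false x + Literature.Analysis.FluidPDE.Torus.stokesMode (Pi.single (0 : Fin 3) (1 : ℤ)) (EuclideanSpace.single (1 : Fin 3) (1 : ℝ)) false x + Literature.Analysis.FluidPDE.Torus.stokesMode (Pi.single (1 : Fin 3) (1 : ℤ)) (EuclideanSpace.single (2 : Fin 3) (1 : ℝ)) false x : EuclideanSpace ℝ (Fin 3))) := by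
  sorry

/-! ## Name-keyed aliases of the two stub statements — the hypotheses of `GPLoudFamilyZ_of`

The native skeleton audit (`#h21_check_skeleton`, run by `ledger skeleton check`) admits a hypothesis of the
composing theorem only if its head constant is a registered obligation or is NAMED like a declared stub;
`__Registered.stub_X` is the statement of `stub_X` verbatim under the stub's short name (device of
`Cruxes/MirrorFloorTG/Lines/birth.lean` and `Cruxes/CyclicWindLineLoud/Lines/birth.lean`; the `__` namespace
is an implementation detail, so the audit's stub report resolves each `stub_…` to the sorried theorem above,
not to its alias).  Each alias is an `abbrev`, definitionally (and textually) its stub's signature —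
generated from the same source text. -/
namespace __Registered

/-- Alias of the statement of `stub_boundedSteadyGPStates` (bounded steady GP states at arbitrarily small
viscosity), keyed by the stub name. -/
abbrev stub_boundedSteadyGPStates : Prop :=
  ∃ E : ℝ, ∀ ν₀ : ℝ, 0 < ν₀ → ∃ ν : ℝ, 0 < ν ∧ ν < ν₀ ∧ ∃ u : ↥(Literature.Analysis.FunctionSpaces.Torus.energySpace (Fin 3)), (u : MeasureTheory.Lp (EuclideanSpace ℝ (Fin 3)) 2 (MeasureTheory.volume : MeasureTheory.Measure (UnitAddTorus (Fin 3)))) ∈ Literature.Analysis.FunctionSpaces.Torus.energySpaceV (Fin 3) ∧ Literature.Analysis.FluidPDE.Torus.IsSteadyWeakSolution ν (fun x : UnitAddTorus (Fin 3) => (Literature.Analysis.FluidPDE.Torus.stokesMode (Pi.single (2 : Fin 3) (1 : ℤ)) (EuclideanSpace.single (0 : Fin 3) (1 : ℝ)) false x + Literature.Analysis.FluidPDE.Torus.stokesMode (Pi.single (0 : Fin 3) (1 : ℤ)) (EuclideanSpace.single (1 : Fin 3) (1 : ℝ)) false x + Literature.Analysis.FluidPDE.Torus.stokesMode (Pi.single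 (1 : Fin 3) (1 : ℤ)) (EuclideanSpace.single (2 : Fin 3) (1 : ℝ)) false x : EuclideanSpace ℝ (Fin 3))) u ∧ ‖u‖ ^ 2 ≤ E

/-- Alias of the statement of `stub_boundedSteadyGPStatesLoud` (bounded steady GP states are loud), keyed
by the stub name. -/
abbrev stub_boundedSteadyGPStatesLoud : Prop :=
  ∀ E : ℝ, ∃ ε ν₁ : ℝ, 0 < ε ∧ 0 < ν₁ ∧ ∀ ν : ℝ, 0 < ν → ν < ν₁ → ∀ u : ↥(Literature.Analysis.FunctionSpaces.Torus.energySpace (Fin 3)), (u : MeasureTheory.Lp (EuclideanSpace ℝ (Fin 3)) 2 (MeasureTheory.volume : MeasureTheory.Measure (UnitAddTorus (Fin 3)))) ∈ Literature.Analysis.FunctionSpaces.Torus.energySpaceV (Fin 3) → Literature.Analysis.FluidPDE.Torus.IsSteadyWeakSolution ν (fun x : UnitAddTorus (Fin 3) => (Literature.Analysis.FluidPDE.Torus.stokesMode (Pi.single (2 : Fin 3) (1 : ℤ)) (EuclideanSpace.single (0 : Fin 3) (1 : ℝ)) false x + Literature.Analysis.FluidPDE.Torus.stokesMode (Pi.single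 (0 : Fin 3) (1 : ℤ)) (EuclideanSpace.single (1 : Fin 3) (1 : ℝ)) false x + Literature.Analysis.FluidPDE.Torus.stokesMode (Pi.single (1 : Fin 3) (1 : ℤ)) (EuclideanSpace.single (2 : Fin 3) (1 : ℝ)) false x : EuclideanSpace ℝ (Fin 3))) u → ‖u‖ ^ 2 ≤ E → ε ≤ Literature.Analysis.FluidPDE.Torus.pairing (u : MeasureTheory.Lp (EuclideanSpace ℝ (Fin 3)) 2 (MeasureTheory.volume : MeasureTheory.Measure (UnitAddTorus (Fin 3)))) (fun x : UnitAddTorus (Fin 3) => (Literature.Analysis.FluidPDE.Torus.stokesMode (Pi.single (2 : Fin 3) (1 : ℤ)) (EuclideanSpace.single (0 : Fin 3) (1 : ℝ)) false x + Literature.Analysis.FluidPDE.Torus.stokesMode (Pi.single (0 : Fin 3) (1 : ℤ)) (EuclideanSpace.single (1 : Fin 3) (1 : ℝ)) false x + Literature.Analysis.FluidPDE.Torus.stokesMode (Pi.single (1 : Fin 3) (1 : ℤ)) (EuclideanSpace.single (2 : Fin 3) (1 : ℝ)) false x : EuclideanSpace ℝ (Fin 3)))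

end __Registered

/-- **Composition** (kernel-checked, no `sorry` of its own): the two stub statements (as the name-keyed
aliases `__Registered.stub_*`) imply the crux
`Summit.AnomalousDissipation.AnomalousDissipation.Theses.FrustratedForces.GPLoudFamilyZ` BY NAME.
`E` from stub 1, `ε, ν₁` from stub 2 at `E`; viscosities `ν_j ∈ (0, min ν₁ 1/(j+1))` and bounded steady
states `u_j` chosen from stub 1; loud by stub 2; power = dissipation by Temam's energy identity
(`Torus.IsSteadyWeakSolution.energy_eq'`); constant paths are global Leray–Hopf with
`meanDissipation = ν‖∇u‖²` (`Theorems.steadyWeakIsGlobalLerayHopf_proof`); data in `H` are mean zero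
(`Torus.integral_eq_zero_of_mem_energySpace`); `f_GP` smooth and mean zero
(`Theorems.SteadyStatesLoudBounded.GpAdmissible.stub_gpAdmissible`). [folklore] -/
theorem GPLoudFamilyZ_of :
    __Registered.stub_boundedSteadyGPStates → __Registered.stub_boundedSteadyGPStatesLoud →
      Summit.AnomalousDissipation.AnomalousDissipation.Theses.FrustratedForces.GPLoudFamilyZ := by
  intro hA hB
  dsimp only [__Registered.stub_boundedSteadyGPStates, __Registered.stub_boundedSteadyGPStatesLoud] at hA hB
  obtain ⟨E, hA⟩ := hA
  obtain ⟨ε, ν₁, hε, hν₁, hB⟩ := hB E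
  -- thresholds `μ / (j+1)`, `μ := min ν₁ 1`
  set μ : ℝ := min ν₁ 1 with hμ
  have hμ0 : 0 < μ := lt_min hν₁ one_pos
  have hθpos : ∀ j : ℕ, 0 < μ / ((j : ℝ) + 1) := fun j => by positivity
  have hθle : ∀ j : ℕ, μ / ((j : ℝ) + 1) ≤ μ := fun j => by
    rw [div_le_iff₀ (by positivity)]
    have hj : (0 : ℝ) ≤ (j : ℝ) := Nat.cast_nonneg j
    nlinarith
  -- a viscosity below the threshold and a bounded steady state, at every `j` (stub 1)
  choose ν hpos hlt u hV hsol hE using fun j : ℕ => hA (μ / ((j : ℝ) + 1)) (hθpos j)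
  have hlt₁ : ∀ j, ν j < ν₁ := fun j => (hlt j).trans_le ((hθle j).trans (min_le_left _ _))
  have hle1 : ∀ j, ν j ≤ 1 := fun j => ((hlt j).trans_le ((hθle j).trans (min_le_right _ _))).le
  -- admissibility of the Galloway–Proctor force (tree theorem)
  obtain ⟨hs, -, hz⟩ :=
    Summit.AnomalousDissipation.AnomalousDissipation.Theorems.SteadyStatesLoudBounded.GpAdmissible.stub_gpAdmissible
  -- Temam's energy identity: power = dissipation at a steady weak solution in `V`
  have heq : ∀ j, ν j * (Literature.Analysis.FunctionSpaces.Torus.eGradNormSq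
      ((u j : MeasureTheory.Lp (EuclideanSpace ℝ (Fin 3)) 2 (MeasureTheory.volume : MeasureTheory.Measure (UnitAddTorus (Fin 3)))) : UnitAddTorus (Fin 3) → EuclideanSpace ℝ (Fin 3))).toReal =
        Literature.Analysis.FluidPDE.Torus.pairing (u j : MeasureTheory.Lp (EuclideanSpace ℝ (Fin 3)) 2 (MeasureTheory.volume : MeasureTheory.Measure (UnitAddTorus (Fin 3)))) (fun x : UnitAddTorus (Fin 3) => (Literature.Analysis.FluidPDE.Torus.stokesMode (Pi.single (2 : Fin 3) (1 : ℤ)) (EuclideanSpace.single (0 : Fin 3) (1 : ℝ)) false x + Literature.Analysis.FluidPDE.Torus.stokesMode (Pi.single (0 : Fin 3) (1 : ℤ)) (EuclideanSpace.single (1 : Fin 3) (1 : ℝ)) false x + Literature.Analysis.FluidPDE.Torus.stokesMode (Pi.single (1 : Fin 3) (1 : ℤ)) (EuclideanSpace.single (2 : Fin 3) (1 : ℝ)) false x : EuclideanSpace ℝ (Fin 3))) := fun j =>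
    Literature.Analysis.FluidPDE.Torus.IsSteadyWeakSolution.energy_eq' (by simp) (hs.memLp 2) (hV j) (hsol j)
  -- realisation: the constant path is a global Leray–Hopf solution with `meanDissipation = ν‖∇u‖²`
  have hR := fun j =>
    Summit.AnomalousDissipation.AnomalousDissipation.Theorems.steadyWeakIsGlobalLerayHopf_proof (ν j) (fun x : UnitAddTorus (Fin 3) => (Literature.Analysis.FluidPDE.Torus.stokesMode (Pi.single (2 : Fin 3) (1 : ℤ)) (EuclideanSpace.single (0 : Fin 3) (1 : ℝ)) false x + Literature.Analysis.FluidPDE.Torus.stokesMode (Pi.single (0 : Fin 3) (1 : ℤ)) (EuclideanSpace.single (1 : Fin 3) (1 : ℝ)) false x + Literature.Analysis.FluidPDE.Torus.stokesMode (Pi.single (1 : Fin 3) (1 : ℤ)) (EuclideanSpace.single (2 : Fin 3) (1 : ℝ)) false x : EuclideanSpace ℝ (Fin 3)))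
      (u j) (hpos j) hs hz (hV j) (hsol j) (heq j)
  refine ⟨ε, hε, ν, fun j => ((u j : MeasureTheory.Lp (EuclideanSpace ℝ (Fin 3)) 2 (MeasureTheory.volume : MeasureTheory.Measure (UnitAddTorus (Fin 3)))) : UnitAddTorus (Fin 3) → EuclideanSpace ℝ (Fin 3)),
    fun j => fun _ => ((u j : MeasureTheory.Lp (EuclideanSpace ℝ (Fin 3)) 2 (MeasureTheory.volume : MeasureTheory.Measure (UnitAddTorus (Fin 3)))) : UnitAddTorus (Fin 3) → EuclideanSpace ℝ (Fin 3)),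
    fun j => ⟨hpos j, hle1 j⟩, ?_, fun j => ?_, fun j => (hR j).1, fun j => ?_⟩
  · -- `ν_j → 0`, squeezed between `0` and `μ/(j+1) → 0`
    have h0 : Tendsto (fun j : ℕ => μ / ((j : ℝ) + 1)) atTop (nhds 0) :=
      tendsto_const_nhds.div_atTop (tendsto_atTop_add_const_right _ _ tendsto_natCast_atTop_atTop)
    exact tendsto_of_tendsto_of_tendsto_of_le_of_le tendsto_const_nhds h0 (fun j => (hpos j).le)
      (fun j => (hlt j).le)
  · -- data in `H` are mean zero
    exact Literature.Analysis.FluidPDE.Torus.integral_eq_zero_of_mem_energySpace (u j).2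
  · -- loudness: meanDissipation = ν‖∇u‖² = (u, f_GP) ≥ ε (stub 2 at the bounded steady state `u_j`)
    rw [(hR j).2.2, heq j]
    exact hB (ν j) (hpos j) (hlt₁ j) (u j) (hV j) (hsol j) (hE j)

/-- WIRING CHECK: the two sorried stubs compose to a closed term of the crux's type (modulo their `sorry`s).
Deliberately an `example` (no constant enters the environment), so that a BC3 probe importing this file could
not close `stub → GPLoudFamilyZ` by `exact?` through a pre-composed witness. -/
example : Summit.AnomalousDissipation.AnomalousDissipation.Theses.FrustratedForces.GPLoudFamilyZ :=
  GPLoudFamilyZ_of stub_boundedSteadyGPStates stub_boundedSteadyGPStatesLoud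

end Summit.AnomalousDissipation.AnomalousDissipation.Cruxes.GPLoudFamilyZ.Birth

end
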